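import Summits.Ventures.Crystal3D.Theorems.StickyWulffConstantCoaxialWallLawTriadicRegistryCoaxial
import Summits.Ventures.Crystal3D.Theorems.StickyWulffConstantGenericWallFloorStackLedgerOffReachWith
import Summits.Ventures.Crystal3D.Theorems.StickyWulffConstantCoaxialWallLawLedgerWithCharge
import HarnessLib

/-!
# Restatement programme, reach cone: the NON-TRIADIC offset path AT explicit constants (`R₀ = 10`)

HONEST FRAMING. Venture `Summits/Ventures/Crystal3D` (cell `crystal3d-full`); helper for the crux `TextureLiminf` (stmt-Ventures-19483,
line `TexShadow`) and lane F's debt F-U (cf-p1 DECISION (lxvii), 2026-08-29).  Rung credit only (census-free, standard axioms); F-C1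
not moved; E1 (`ExactOnly`) and `StarPairFar` stay BY NAME.  The links above leaf L2 (`twoSlabAdhesionWith_stackLedger_offReach`,
…StackLedgerOffReachWith) in the explicit-constant currency, proofs = the originals' (`…GenericWallFloorOffReach`,
`…CoaxialWallLawTriadicRegistry`, `…TriadicRegistryCoaxial`) with `At` ↦ `With`:

* `twoSlabLedgerWith_offReach` (↔ `twoSlabLedgerAt_offReach`),
* `twoSlabLedgerWith_one_of_not_triadic` (↔ `twoSlabLedgerAt_one_of_not_triadic`, charge `1`),
* `coaxialOnWith_of_not_triadic` (↔ `coaxialTwoSlabAdhesion_of_not_triadic`): the conclusion of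
  `CoaxialTwoSlabAdhesionOnWith C 10` for every co-axial pair with a non-triadic offset, ONE `C = (240√2π + 4440·42)/2 + 2000 + K`.
-/

noncomputable section

namespace Summit.Ventures.Crystal3D.Theorems

open Summit.Ventures.Crystal3D Finset
open Literature.MathematicalPhysics.StatisticalMechanics (fccStacking barlowStacking IsHaggSeq contactDeficiency)
open scoped InnerProductSpace

open scoped Classical in
/-- **The matrix per pair at full charge, off the registry set, explicit constants** (any steep slots `u₁` up / `u₂` down, frame
sets `Mᵢ` containing the frames of all sound well-formed stacks over the bottoms, disjoint reach sets); one absolute `K`. -/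
theorem twoSlabLedgerWith_offReach : ∃ K : ℝ, ∀
    {s₀ : EuclideanSpace ℝ (Fin 3)} (_hs₀ : s₀ ∈ fccSlots)
    (_hcert : ExactOnly 0 (fccSlots.filter fun w => 0 < ⟪w, s₀⟫_ℝ)) (_hfar : StarPairFar)
    (A₁ : EuclideanSpace ℝ (Fin 3) ≃ₗᵢ[ℝ] EuclideanSpace ℝ (Fin 3)) (t₁ : EuclideanSpace ℝ (Fin 3))
    (A₂ : EuclideanSpace ℝ (Fin 3) ≃ₗᵢ[ℝ] EuclideanSpace ℝ (Fin 3)) (t₂ : EuclideanSpace ℝ (Fin 3))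
    {u₁ : EuclideanSpace ℝ (Fin 3)} (_hu₁ : u₁ ∈ fccSlots)
    (_hsteep₁ : Real.sqrt 2 / 2 ≤ ⟪A₁ u₁, EuclideanSpace.single (2 : Fin 3) (1 : ℝ)⟫_ℝ)
    {u₂ : EuclideanSpace ℝ (Fin 3)} (_hu₂ : u₂ ∈ fccSlots)
    (_hsteep₂ : ⟪A₂ u₂, EuclideanSpace.single (2 : Fin 3) (1 : ℝ)⟫_ℝ ≤ -(Real.sqrt 2 / 2))
    (M₁ M₂ : Set (EuclideanSpace ℝ (Fin 3) ≃ₗᵢ[ℝ] EuclideanSpace ℝ (Fin 3)))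
    (_hM₁ : ∀ stk : List WalkEntry, StackSound (EuclideanSpace.single (2 : Fin 3) (1 : ℝ)) stk →
      StackWF (EuclideanSpace.single (2 : Fin 3) (1 : ℝ)) stk → stk.getLast? = some ⟨A₁, u₁, 0⟩ →
      ∀ e ∈ stk, e.frame ∈ M₁)
    (_hM₂ : ∀ stk : List WalkEntry, StackSound (-EuclideanSpace.single (2 : Fin 3) (1 : ℝ)) stk →
      StackWF (-EuclideanSpace.single (2 : Fin 3) (1 : ℝ)) stk → stk.getLast? = some ⟨A₂, u₂, 0⟩ →
      ∀ e ∈ stk, e.frame ∈ M₂)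
    (_hoff : ∀ y ∈ reachSet A₁ t₁ M₁, y ∉ reachSet A₂ t₂ M₂),
    TwoSlabLedgerWith ((240 * Real.sqrt 2 * Real.pi + 4440 * (4 * 10 + 2)) / 2 + 2000 + K) 10
      ((Real.sqrt 2 * |⟪A₁ u₁, EuclideanSpace.single (2 : Fin 3) (1 : ℝ)⟫_ℝ| +
        Real.sqrt 2 * |⟪A₂ u₂, EuclideanSpace.single (2 : Fin 3) (1 : ℝ)⟫_ℝ|) / 2) A₁ t₁ A₂ t₂ := by
  obtain ⟨K, hK⟩ := twoSlabAdhesionWith_stackLedger_offReach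
  refine ⟨K, ?_⟩
  intro s₀ hs₀ hcert hfar A₁ t₁ A₂ t₂ u₁ hu₁ hsteep₁ u₂ hu₂ hsteep₂ M₁ M₂ hM₁ hM₂ hoff
  exact hK hs₀ hcert (doubleStarCoaxialAt_of_starPairFar hfar) (capPairCoaxial_of_starPairFar hfar) A₁ t₁ A₂ t₂ hu₁ hsteep₁
    hu₂ hsteep₂ M₁ M₂ hM₁ hM₂ hoff

open scoped Classical in
/-- **Charge `1` for every pair with a non-triadic relative translation, explicit constants** (arbitrary fillings, modulo E1 and
`StarPairFar`); one absolute `K`. -/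
theorem twoSlabLedgerWith_one_of_not_triadic : ∃ K : ℝ, ∀
    {s₀ : EuclideanSpace ℝ (Fin 3)} (_hs₀ : s₀ ∈ fccSlots)
    (_hcert : ExactOnly 0 (fccSlots.filter fun w => 0 < ⟪w, s₀⟫_ℝ)) (_hfar : StarPairFar)
    {A₁ : EuclideanSpace ℝ (Fin 3) ≃ₗᵢ[ℝ] EuclideanSpace ℝ (Fin 3)} {t₁ : EuclideanSpace ℝ (Fin 3)}
    {A₂ : EuclideanSpace ℝ (Fin 3) ≃ₗᵢ[ℝ] EuclideanSpace ℝ (Fin 3)} {t₂ : EuclideanSpace ℝ (Fin 3)}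
    (_hA₂ : ∀ x ∈ fccStacking 1 (Real.sqrt (2 / 3)),
      ∃ j : ℕ, ((3 : ℝ) ^ j) • A₁.symm (A₂ x) ∈ fccStacking 1 (Real.sqrt (2 / 3)))
    (_ht : ¬ ∃ j : ℕ, ((3 : ℝ) ^ j) • A₁.symm (t₂ - t₁) ∈ fccStacking 1 (Real.sqrt (2 / 3))),
    TwoSlabLedgerWith ((240 * Real.sqrt 2 * Real.pi + 4440 * (4 * 10 + 2)) / 2 + 2000 + K) 10 1 A₁ t₁ A₂ t₂ := by
  obtain ⟨K, hK⟩ := twoSlabLedgerWith_offReach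
  refine ⟨K, ?_⟩
  intro s₀ hs₀ hcert hfar A₁ t₁ A₂ t₂ hA₂ ht
  obtain ⟨u₁, hu₁, hsteep₁⟩ := exists_steep_slot_up A₁
  obtain ⟨u₂, hu₂, hsteep₂⟩ := exists_steep_slot_down A₂
  have hoff : t₂ - t₁ ∉ registrySet A₁ A₂ (chainFrames (EuclideanSpace.single (2 : Fin 3) (1 : ℝ)) A₁ u₁)
      (chainFrames (-EuclideanSpace.single (2 : Fin 3) (1 : ℝ)) A₂ u₂) :=
    fun hmem => ht (registrySet_chainFrames_subset_triadic hA₂ hmem)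
  have h := hK hs₀ hcert hfar A₁ t₁ A₂ t₂ hu₁ hsteep₁ hu₂ hsteep₂ _ _
    (fun _ hS hW hlast => frame_mem_chainFrames_of_stack hS hW hlast)
    (fun _ hS hW hlast => frame_mem_chainFrames_of_stack hS hW hlast)
    (reachSet_disjoint_of_not_mem_registrySet hoff)
  refine twoSlabLedgerWith_anti ?_ h
  have hκ₁ := one_le_flux_of_steep (A := A₁) (u := u₁) (le_trans hsteep₁ (le_abs_self _))
  have hκ₂ : 1 ≤ Real.sqrt 2 * |⟪A₂ u₂, EuclideanSpace.single (2 : Fin 3) (1 : ℝ)⟫_ℝ| := by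
    refine one_le_flux_of_steep (A := A₂) (u := u₂) ?_
    rw [abs_of_nonpos (by linarith only [hsteep₂, Real.sqrt_nonneg 2] :
      ⟪A₂ u₂, EuclideanSpace.single (2 : Fin 3) (1 : ℝ)⟫_ℝ ≤ 0)]
    linarith only [hsteep₂]
  linarith only [hκ₁, hκ₂]

open scoped Classical in
/-- **Lane F's stub conclusion at explicit constants for co-axial pairs with a non-triadic offset** (the defender's frame = the
common frame `L` of the data, charge `½·√(1 − ⟪L e₃, e₃⟫²) ≤ 1`); one absolute `K`. -/
theorem coaxialOnWith_of_not_triadic : ∃ K : ℝ, ∀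
    {s₀ : EuclideanSpace ℝ (Fin 3)} (_hs₀ : s₀ ∈ fccSlots)
    (_hcert : ExactOnly 0 (fccSlots.filter fun w => 0 < ⟪w, s₀⟫_ℝ)) (_hfar : StarPairFar)
    (A₁ : EuclideanSpace ℝ (Fin 3) ≃ₗᵢ[ℝ] EuclideanSpace ℝ (Fin 3)) (t₁ : EuclideanSpace ℝ (Fin 3))
    (A₂ : EuclideanSpace ℝ (Fin 3) ≃ₗᵢ[ℝ] EuclideanSpace ℝ (Fin 3)) (t₂ : EuclideanSpace ℝ (Fin 3))
    (_hco : ∃ (L : EuclideanSpace ℝ (Fin 3) ≃ₗᵢ[ℝ] EuclideanSpace ℝ (Fin 3))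
        (s₁ s₂ : EuclideanSpace ℝ (Fin 3)) (σ σ' : ℤ → ℤ), IsHaggSeq σ ∧ IsHaggSeq σ' ∧
        (fun p => A₁ p + t₁) '' fccStacking 1 (Real.sqrt (2 / 3)) ⊆
          (fun p => L p + s₁) '' barlowStacking 1 (Real.sqrt (2 / 3)) σ ∧
        (fun p => A₂ p + t₂) '' fccStacking 1 (Real.sqrt (2 / 3)) ⊆
          (fun p => L p + s₂) '' barlowStacking 1 (Real.sqrt (2 / 3)) σ')
    (_ht : ¬ ∃ j : ℕ, ((3 : ℝ) ^ j) • A₁.symm (t₂ - t₁) ∈ fccStacking 1 (Real.sqrt (2 / 3))),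
    ∃ (L : EuclideanSpace ℝ (Fin 3) ≃ₗᵢ[ℝ] EuclideanSpace ℝ (Fin 3))
        (s₁ s₂ : EuclideanSpace ℝ (Fin 3)) (σ σ' : ℤ → ℤ), IsHaggSeq σ ∧ IsHaggSeq σ' ∧
        (fun p => A₁ p + t₁) '' fccStacking 1 (Real.sqrt (2 / 3)) ⊆
          (fun p => L p + s₁) '' barlowStacking 1 (Real.sqrt (2 / 3)) σ ∧
        (fun p => A₂ p + t₂) '' fccStacking 1 (Real.sqrt (2 / 3)) ⊆
          (fun p => L p + s₂) '' barlowStacking 1 (Real.sqrt (2 / 3)) σ' ∧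
        TwoSlabLedgerWith ((240 * Real.sqrt 2 * Real.pi + 4440 * (4 * 10 + 2)) / 2 + 2000 + K) 10
          ((1 / 2 : ℝ) * Real.sqrt (1 - ⟪L (EuclideanSpace.single (2 : Fin 3) (1 : ℝ)),
            (EuclideanSpace.single (2 : Fin 3) (1 : ℝ))⟫_ℝ ^ 2)) A₁ t₁ A₂ t₂ := by
  obtain ⟨K, hK⟩ := twoSlabLedgerWith_one_of_not_triadic
  refine ⟨K, ?_⟩
  intro s₀ hs₀ hcert hfar A₁ t₁ A₂ t₂ hco ht
  have hone := hK hs₀ hcert hfar (triadicLattice_of_coaxial A₁ t₁ A₂ t₂ hco) ht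
  obtain ⟨L, s₁, s₂, σ, σ', hσ, hσ', hsub₁, hsub₂⟩ := hco
  have hle : (1 / 2 : ℝ) * Real.sqrt (1 - ⟪L (EuclideanSpace.single (2 : Fin 3) (1 : ℝ)),
      (EuclideanSpace.single (2 : Fin 3) (1 : ℝ))⟫_ℝ ^ 2) ≤ 1 := by
    have h1 : Real.sqrt (1 - ⟪L (EuclideanSpace.single (2 : Fin 3) (1 : ℝ)),
        (EuclideanSpace.single (2 : Fin 3) (1 : ℝ))⟫_ℝ ^ 2) ≤ 1 := by
      rw [show (1 : ℝ) = Real.sqrt 1 from Real.sqrt_one.symm]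
      exact Real.sqrt_le_sqrt (by rw [Real.sqrt_one]; nlinarith [sq_nonneg ⟪L (EuclideanSpace.single (2 : Fin 3) (1 : ℝ)),
        (EuclideanSpace.single (2 : Fin 3) (1 : ℝ))⟫_ℝ])
    linarith
  exact ⟨L, s₁, s₂, σ, σ', hσ, hσ', hsub₁, hsub₂, twoSlabLedgerWith_anti hle hone⟩

end Summit.Ventures.Crystal3D.Theorems

end
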